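import Literature.Analysis.FunctionSpaces.TorusSobolevL6
import Literature.Analysis.FunctionSpaces.TorusEnstrophyOrthogonality
import Literature.Analysis.FunctionSpaces.TorusRieszTransform
import HarnessLib

/-!
# The trilinear enstrophy estimate `|b(u, u, Δu)| ≤ c ‖∇u‖₂^{3/2} ‖Δu‖₂^{3/2}` on `T³`

Analysis/FunctionSpaces support file (everything proved; no definitions, no named facts), sequel of
`TorusEnstrophyOrthogonality.lean` (the identity `∫ ⟪Δu, (u·∇)u⟫ = −∫ ∑∑ (∂ₘu)ᵢ ⟪∂ₘu, ∂ᵢu⟫` for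
divergence-free fields, every dimension) and `TorusSobolevL6.lean` (Ladyzhenskaya's inequality in
three dimensions). It proves the three-dimensional estimate of the inertial term against the
Laplacian that drives every `H¹` (enstrophy) argument for the space-periodic Navier–Stokes
equations — Foias–Manley–Rosa–Temam 2001, Ch. II App. A, **(A.26b)** with `v = u`, `w = Au`:
`|b(u, u, Au)| ≤ c₁ ‖u‖^{3/2} |Au|^{3/2}` (`‖u‖ = |∇u|_{L²}`, `A = −Δ` on periodic divergence-free
fields) — in the tree's vocabulary:

* `Torus.abs_sum_partialDeriv_mul_inner_le` — the pointwise bound of the cubic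
  ("vortex-stretching") density, `|∑ₘ∑ᵢ (∂ₘu)ᵢ ⟪∂ₘu, ∂ᵢu⟫| ≤ d² |∇u|² √(|∇u|²)`,
  `|∇u|² = ∑ₘ ‖∂ₘu‖²`;
* `Torus.gradNormSq_partialDeriv_le` — `‖∇∂ₘu‖₂² ≤ d ‖Δu‖₂²` (the `L²` Hessian bound
  `∫ (∂ᵢ∂ₘw)² ≤ ∫ (Δw)²` of `TorusRieszTransform`, coordinate by coordinate);
* `Torus.sum_gradNormSq_partialDeriv_eq` — `∑ₘ ‖∇∂ₘu‖₂² = ‖Δu‖₂²` (two integrations by parts),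
  and its Poincaré consequence `Torus.gradNormSq_le_card_pow_mul_integral_norm_laplacian_sq`,
  `‖∇u‖₂² ≤ d³ ‖Δu‖₂²` for every smooth `u` (the `∂ₘu` have zero mean);
* `Torus.integral_sum_norm_sq_partialDeriv_sq_le` — `∫ |∇u|⁴ ≤ K ‖∇u‖₂ ‖Δu‖₂³` for smooth `u` on
  `T³` (Ladyzhenskaya's inequality applied to the zero-mean fields `∂ₘu`);
* `Torus.abs_integral_inner_convect_laplacian_le` — **the estimate**: on `T^d` with `card d = 3`
  there is `K` such that for every smooth divergence-free `u : T^d → ℝ^d`,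
  `|∫ ⟪(u·∇)u, Δu⟫| ≤ K (‖∇u‖₂²)^{3/4} (‖Δu‖₂²)^{3/4}` with `‖∇u‖₂² = Torus.gradNormSq u` and
  `‖Δu‖₂² = ∫ ‖Torus.laplacian u‖²`;
* `Torus.abs_integral_inner_convect_laplacian_le_dissipation` — the Young-type consequence used
  along solutions: for every `ν > 0`,
  `|∫ ⟪(u·∇)u, Δu⟫| ≤ (ν/2) ‖Δu‖₂² + (8K⁴/ν³) (‖∇u‖₂²)³`.

FMRT derive (A.26) "by applying Hölder's inequality, the Ladyzhenskaya inequality (A.27) and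
Agmon's inequalities"; here (A.26b) for `b(u,u,Au)` is obtained from the integrated-by-parts form
of `TorusEnstrophyOrthogonality` by Hölder and (A.27) applied to `∇u` (whose components have zero
mean), which avoids Agmon's inequality. Constants are existential.

## Mathlib / tree search

Tree: `TorusEnstrophyOrthogonality` (identity and 2D vanishing), `TorusSobolevL6` (3D
Ladyzhenskaya), `TorusRieszTransform` (`L²` Hessian bound), `TorusClassicalH1Balance`
(enstrophy equation); no trilinear `H¹ × H²` estimate on the torus (searched `A.26`, `trilinear`,
`3/4`, `convect` with `laplacian` under `FunctionSpaces/`, `FluidPDE/Torus*`). Mathlib: nothing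
periodic.

## References

* C. Foias, O. Manley, R. Rosa, R. Temam, *Navier–Stokes Equations and Turbulence*, CUP 2001,
  Ch. II App. A, (A.26b), (A.27), PDF p. 113. [FoiasManleyRosaTemam2001]
* P. Constantin, C. Foias, *Navier–Stokes Equations*, Univ. Chicago Press 1988, Ch. 6
  (inequalities for the trilinear form, `n = 3`). [ConstantinFoias1988]
-/

noncomputable section

open MeasureTheory Set Filter Function
open scoped ENNReal NNReal InnerProductSpace ContDiff

namespace Literature.Analysis.FunctionSpaces

namespace Torus

variable {d : Type*} [Fintype d] [DecidableEq d]

/-! ### The cubic density -/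

omit [DecidableEq d] in
/-- **Pointwise bound of the vortex-stretching density**: for any family of vectors
`R : d → ℝ^d` (the rows `∂ₘu(x)`), `|∑ₘ∑ᵢ (Rₘ)ᵢ ⟪Rₘ, Rᵢ⟫| ≤ d² · S · √S` with `S = ∑ₘ ‖Rₘ‖²`
(each factor is at most `√S`). [folklore] -/
theorem abs_sum_apply_mul_inner_le (R : d → EuclideanSpace ℝ d) :
    |∑ m, ∑ i, R m i * ⟪R m, R i⟫_ℝ| ≤
      (Fintype.card d : ℝ) ^ 2 * (∑ m, ‖R m‖ ^ 2) * Real.sqrt (∑ m, ‖R m‖ ^ 2) := by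
  set S : ℝ := ∑ m, ‖R m‖ ^ 2 with hS
  have hS0 : 0 ≤ S := Finset.sum_nonneg fun m _ => sq_nonneg _
  have hle : ∀ m, ‖R m‖ ≤ Real.sqrt S := fun m => by
    rw [← Real.sqrt_sq (norm_nonneg (R m))]
    exact Real.sqrt_le_sqrt (Finset.single_le_sum (f := fun m => ‖R m‖ ^ 2)
      (fun m _ => sq_nonneg _) (Finset.mem_univ m))
  have hterm : ∀ m i, |R m i * ⟪R m, R i⟫_ℝ| ≤ S * Real.sqrt S := by
    intro m i
    rw [abs_mul]
    have h1 : |R m i| ≤ Real.sqrt S := by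
      have h := PiLp.norm_apply_le (R m) i
      rw [Real.norm_eq_abs] at h
      exact h.trans (hle m)
    have h2 : |⟪R m, R i⟫_ℝ| ≤ Real.sqrt S * Real.sqrt S :=
      (abs_real_inner_le_norm _ _).trans (mul_le_mul (hle m) (hle i) (norm_nonneg _) (Real.sqrt_nonneg _))
    calc |R m i| * |⟪R m, R i⟫_ℝ| ≤ Real.sqrt S * (Real.sqrt S * Real.sqrt S) :=
          mul_le_mul h1 h2 (abs_nonneg _) (Real.sqrt_nonneg _)
      _ = S * Real.sqrt S := by rw [Real.mul_self_sqrt hS0]; ring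
  calc |∑ m, ∑ i, R m i * ⟪R m, R i⟫_ℝ| ≤ ∑ m, |∑ i, R m i * ⟪R m, R i⟫_ℝ| := Finset.abs_sum_le_sum_abs _ _
    _ ≤ ∑ m, ∑ i, |R m i * ⟪R m, R i⟫_ℝ| := Finset.sum_le_sum fun m _ => Finset.abs_sum_le_sum_abs _ _
    _ ≤ ∑ _m : d, ∑ _i : d, S * Real.sqrt S :=
        Finset.sum_le_sum fun m _ => Finset.sum_le_sum fun i _ => hterm m i
    _ = (Fintype.card d : ℝ) ^ 2 * S * Real.sqrt S := by
        simp only [Finset.sum_const, Finset.card_univ, nsmul_eq_mul]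
        ring

/-- The vortex-stretching density of a field: `|∑ₘ∑ᵢ (∂ₘu)ᵢ ⟪∂ₘu, ∂ᵢu⟫| ≤ d² |∇u|² √(|∇u|²)`
pointwise, `|∇u|²(x) = ∑ₘ ‖∂ₘu(x)‖²`. [folklore] -/
theorem abs_sum_partialDeriv_mul_inner_le (u : UnitAddTorus d → EuclideanSpace ℝ d)
    (x : UnitAddTorus d) :
    |∑ m, ∑ i, partialDeriv m u x i * ⟪partialDeriv m u x, partialDeriv i u x⟫_ℝ| ≤
      (Fintype.card d : ℝ) ^ 2 * (∑ m, ‖partialDeriv m u x‖ ^ 2) *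
        Real.sqrt (∑ m, ‖partialDeriv m u x‖ ^ 2) :=
  abs_sum_apply_mul_inner_le fun m => partialDeriv m u x

/-! ### Second derivatives against the Laplacian -/

/-- **`‖∇∂ₘu‖₂² ≤ d ‖Δu‖₂²`** for a smooth field on `T^d`: coordinate by coordinate,
`∫ (∂ᵢ∂ₘu_l)² ≤ ∫ (Δu_l)²` (`Torus.integral_sq_hessian_le_laplacian`, Parseval), summed over
`i` and `l`. [folklore] -/
theorem gradNormSq_partialDeriv_le {u : UnitAddTorus d → EuclideanSpace ℝ d} (hu : IsSmooth u)
    (m : d) :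
    gradNormSq (partialDeriv m u) ≤ Fintype.card d * ∫ x, ‖laplacian u x‖ ^ 2 := by
  have hul : ∀ l, IsSmooth (fun y => u y l) := fun l => hu.apply l
  -- coordinates of second derivatives and of the Laplacian
  have hcoord2 : ∀ i l x, partialDeriv i (partialDeriv m u) x l =
      partialDeriv i (partialDeriv m (fun y => u y l)) x := by
    intro i l x
    have h1 : partialDeriv m (fun y => u y l) = fun y => partialDeriv m u y l := by
      funext y
      exact partialDeriv_apply_coord (hu.isContDiff (by simp)) m y l
    rw [h1]
    exact (partialDeriv_apply_coord ((hu.partialDeriv m).isContDiff (by simp)) i x l).symm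
  have hcoordΔ : ∀ l x, laplacian u x l = laplacian (fun y => u y l) x := by
    intro l x
    set P : EuclideanSpace ℝ d →L[ℝ] ℝ := EuclideanSpace.proj l with hP
    have h : (fun y => u y l) = P ∘ u := rfl
    rw [h, laplacian_eq_sum_partialDeriv_partialDeriv (hu.comp_clm P),
      laplacian_eq_sum_partialDeriv_partialDeriv hu,
      show (∑ i, partialDeriv i (partialDeriv i u) x) l = P (∑ i, partialDeriv i (partialDeriv i u) x)
        from rfl, map_sum]
    refine Finset.sum_congr rfl fun i _ => ?_
    have h1 : partialDeriv i (P ∘ u) = P ∘ partialDeriv i u := funext (partialDeriv_clm_comp hu P i)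
    rw [h1, partialDeriv_clm_comp (hu.partialDeriv i) P i x]
  -- `‖w‖² = ∑_l (w l)²` on `ℝ^d`
  have hnsq : ∀ w : EuclideanSpace ℝ d, ‖w‖ ^ 2 = ∑ l, (w l) ^ 2 := fun w => by
    rw [EuclideanSpace.norm_eq, Real.sq_sqrt (Finset.sum_nonneg fun l _ => sq_nonneg _)]
    exact Finset.sum_congr rfl fun l _ => by rw [Real.norm_eq_abs, sq_abs]
  -- integrability of the coordinate densities
  have hint2 : ∀ i l, Integrable (fun x => (partialDeriv i (partialDeriv m (fun y => u y l)) x) ^ 2) volume :=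
    fun i l => ((((hul l).partialDeriv m).partialDeriv i).continuous.pow 2).integrable_unitAddTorus
  have hintΔ : ∀ l, Integrable (fun x => (laplacian (fun y => u y l) x) ^ 2) volume :=
    fun l => ((hul l).laplacian.continuous.pow 2).integrable_unitAddTorus
  -- the left-hand side, coordinate by coordinate
  have hL : gradNormSq (partialDeriv m u) =
      ∑ i, ∑ l, ∫ x, (partialDeriv i (partialDeriv m (fun y => u y l)) x) ^ 2 := by
    rw [gradNormSq]
    have hpt : ∀ x, ∑ i, ‖partialDeriv i (partialDeriv m u) x‖ ^ 2 =
        ∑ i, ∑ l, (partialDeriv i (partialDeriv m (fun y => u y l)) x) ^ 2 := fun x =>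
      Finset.sum_congr rfl fun i _ => by
        rw [hnsq]
        exact Finset.sum_congr rfl fun l _ => by rw [hcoord2]
    simp_rw [hpt]
    rw [integral_finsetSum _ fun i _ => integrable_finsetSum _ fun l _ => hint2 i l]
    exact Finset.sum_congr rfl fun i _ => integral_finsetSum _ fun l _ => hint2 i l
  -- the right-hand side, coordinate by coordinate
  have hR : ∫ x, ‖laplacian u x‖ ^ 2 = ∑ l, ∫ x, (laplacian (fun y => u y l) x) ^ 2 := by
    have hpt : ∀ x, ‖laplacian u x‖ ^ 2 = ∑ l, (laplacian (fun y => u y l) x) ^ 2 := fun x => by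
      rw [hnsq]
      exact Finset.sum_congr rfl fun l _ => by rw [hcoordΔ]
    simp_rw [hpt]
    exact integral_finsetSum _ fun l _ => hintΔ l
  rw [hL, hR, Finset.mul_sum]
  calc ∑ i, ∑ l, ∫ x, (partialDeriv i (partialDeriv m (fun y => u y l)) x) ^ 2
      ≤ ∑ _i : d, ∑ l, ∫ x, (laplacian (fun y => u y l) x) ^ 2 :=
        Finset.sum_le_sum fun i _ => Finset.sum_le_sum fun l _ =>
          integral_sq_hessian_le_laplacian (hul l) i m
    _ = ∑ l, (Fintype.card d : ℝ) * ∫ x, (laplacian (fun y => u y l) x) ^ 2 := by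
        rw [Finset.sum_const, Finset.card_univ, nsmul_eq_mul, Finset.mul_sum]

/-- **`∑ₘ ‖∇∂ₘu‖₂² = ‖Δu‖₂²`** (the `L²` norm of the Hessian is that of the Laplacian on the
flat torus): integrating by parts twice and commuting partial derivatives,
`∫ ‖∂ᵢ∂ₘu‖² = ∫ ⟪∂ₘ∂ₘu, ∂ᵢ∂ᵢu⟫`, and summing over `i, m` gives `∫ ⟪Δu, Δu⟫`. [folklore] -/
theorem sum_gradNormSq_partialDeriv_eq {u : UnitAddTorus d → EuclideanSpace ℝ d} (hu : IsSmooth u) :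
    ∑ m, gradNormSq (partialDeriv m u) = ∫ x, ‖laplacian u x‖ ^ 2 := by
  have hD : ∀ m, IsSmooth (partialDeriv m u) := fun m => hu.partialDeriv m
  have hDD : ∀ i m, IsSmooth (partialDeriv i (partialDeriv m u)) := fun i m => (hD m).partialDeriv i
  -- each term: `∫ ‖∂ᵢ∂ₘu‖² = ∫ ⟪∂ₘ∂ₘu, ∂ᵢ∂ᵢu⟫`
  have hterm : ∀ i m, ∫ x, ‖partialDeriv i (partialDeriv m u) x‖ ^ 2 =
      ∫ x, ⟪partialDeriv m (partialDeriv m u) x, partialDeriv i (partialDeriv i u) x⟫_ℝ := by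
    intro i m
    have e3 : partialDeriv i (partialDeriv i (partialDeriv m u)) =
        partialDeriv m (partialDeriv i (partialDeriv i u)) := by
      funext y
      rw [show partialDeriv i (partialDeriv m u) = partialDeriv m (partialDeriv i u) from
        funext (partialDeriv_comm hu i m), partialDeriv_comm (hD i) i m y]
    calc ∫ x, ‖partialDeriv i (partialDeriv m u) x‖ ^ 2
        = ∫ x, ⟪partialDeriv i (partialDeriv m u) x, partialDeriv i (partialDeriv m u) x⟫_ℝ :=
          integral_congr_ae (ae_of_all _ fun x => (real_inner_self_eq_norm_sq _).symm)
      _ = -∫ x, ⟪partialDeriv m u x, partialDeriv i (partialDeriv i (partialDeriv m u)) x⟫_ℝ :=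
          integral_inner_partialDeriv_eq_neg (hD m) (hDD i m) i
      _ = -∫ x, ⟪partialDeriv m u x, partialDeriv m (partialDeriv i (partialDeriv i u)) x⟫_ℝ := by
          rw [e3]
      _ = ∫ x, ⟪partialDeriv m (partialDeriv m u) x, partialDeriv i (partialDeriv i u) x⟫_ℝ := by
          rw [integral_inner_partialDeriv_eq_neg (hD m) ((hD i).partialDeriv i) m]
  have hint : ∀ i m, Integrable (fun x => ⟪partialDeriv m (partialDeriv m u) x,
      partialDeriv i (partialDeriv i u) x⟫_ℝ) volume :=
    fun i m => ((hDD m m).inner (hDD i i)).integrable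
  calc ∑ m, gradNormSq (partialDeriv m u)
      = ∑ m, ∑ i, ∫ x, ‖partialDeriv i (partialDeriv m u) x‖ ^ 2 := by
        refine Finset.sum_congr rfl fun m _ => ?_
        rw [gradNormSq]
        exact integral_finsetSum _ fun i _ => ((hDD i m).continuous.norm.pow 2).integrable_unitAddTorus
    _ = ∑ m, ∑ i, ∫ x, ⟪partialDeriv m (partialDeriv m u) x, partialDeriv i (partialDeriv i u) x⟫_ℝ :=
        Finset.sum_congr rfl fun m _ => Finset.sum_congr rfl fun i _ => hterm i m
    _ = ∫ x, ∑ m, ∑ i, ⟪partialDeriv m (partialDeriv m u) x, partialDeriv i (partialDeriv i u) x⟫_ℝ := by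
        rw [integral_finsetSum _ fun m _ => integrable_finsetSum _ fun i _ => hint i m]
        exact Finset.sum_congr rfl fun m _ => (integral_finsetSum _ fun i _ => hint i m).symm
    _ = ∫ x, ⟪laplacian u x, laplacian u x⟫_ℝ := by
        refine integral_congr_ae (ae_of_all _ fun x => ?_)
        dsimp only
        rw [laplacian_eq_sum_partialDeriv_partialDeriv hu, sum_inner]
        exact Finset.sum_congr rfl fun m _ => (inner_sum _ _ _).symm
    _ = ∫ x, ‖laplacian u x‖ ^ 2 := integral_congr_ae (ae_of_all _ fun x => real_inner_self_eq_norm_sq _)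

omit [DecidableEq d] in
/-- For a continuous `g` on the torus, `∫⁻ ‖g‖ₑ² = ofReal (∫ ‖g‖²)`. [folklore] -/
theorem lintegral_enorm_sq_eq_ofReal_integral {G : Type*} [NormedAddCommGroup G]
    {g : UnitAddTorus d → G} (hg : Continuous g) :
    ∫⁻ x, ‖g x‖ₑ ^ 2 = ENNReal.ofReal (∫ x, ‖g x‖ ^ 2) := by
  have hi : Integrable (fun x => ‖g x‖ ^ 2) volume := (hg.norm.pow 2).integrable_unitAddTorus
  rw [ofReal_integral_eq_lintegral_ofReal hi (ae_of_all _ fun x => sq_nonneg _)]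
  exact lintegral_congr fun x => by rw [← ofReal_norm, ENNReal.ofReal_pow (norm_nonneg _)]

/-- **Poincaré for the gradient: `‖∇u‖₂² ≤ d³ ‖Δu‖₂²`** for every smooth field on `T^d` (no
mean condition on `u`: the partial derivatives `∂ₘu` have zero mean, so Poincaré–Wirtinger
`‖∂ₘu‖₂ ≤ d ‖D∂ₘu‖₂` applies to them, `‖D∂ₘu‖² ≤ d ∑ᵢ ‖∂ᵢ∂ₘu‖²`, and
`∑ₘ ‖∇∂ₘu‖₂² = ‖Δu‖₂²`). [folklore] -/
theorem gradNormSq_le_card_pow_mul_integral_norm_laplacian_sq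
    {u : UnitAddTorus d → EuclideanSpace ℝ d} (hu : IsSmooth u) :
    gradNormSq u ≤ (Fintype.card d : ℝ) ^ 3 * ∫ x, ‖laplacian u x‖ ^ 2 := by
  have hD : ∀ m, IsSmooth (partialDeriv m u) := fun m => hu.partialDeriv m
  have hcD : ∀ m, Continuous (Torus.fderiv (partialDeriv m u)) := fun m => by
    have e : lift (Torus.fderiv (partialDeriv m u)) = _root_.fderiv ℝ (lift (partialDeriv m u)) :=
      funext fun y => (fderiv_lift (partialDeriv m u) y).symm
    rw [← continuous_lift_iff, e]
    exact ContDiff.continuous_fderiv ((hD m).isContDiff (n := 1) (by simp)) one_ne_zero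
  -- Poincaré–Wirtinger for `∂ₘu`, in real form
  have hP : ∀ m, ∫ x, ‖partialDeriv m u x‖ ^ 2 ≤
      (Fintype.card d : ℝ) ^ 2 * ∫ x, ‖Torus.fderiv (partialDeriv m u) x‖ ^ 2 := by
    intro m
    have h0 : HasZeroMean (partialDeriv m u) := integral_partialDeriv_eq_zero_holds hu m
    have h := eLpNorm_le_of_hasZeroMean ((hD m).isContDiff (by simp)) h0 (p := 2) (by norm_num)
      ENNReal.ofNat_ne_top
    have h2 := pow_le_pow_left' h 2
    rw [mul_pow, eLpNorm_two_pow_two_eq_lintegral, eLpNorm_two_pow_two_eq_lintegral,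
      lintegral_enorm_sq_eq_ofReal_integral (hD m).continuous] at h2
    simp only [enorm_norm] at h2
    rw [lintegral_enorm_sq_eq_ofReal_integral (hcD m), ← ENNReal.ofReal_natCast, ← ENNReal.ofReal_pow
      (Nat.cast_nonneg _), ← ENNReal.ofReal_mul (by positivity)] at h2
    exact (ENNReal.ofReal_le_ofReal_iff (by positivity)).1 h2
  -- operator norm against partial derivatives
  have hop : ∀ m, ∫ x, ‖Torus.fderiv (partialDeriv m u) x‖ ^ 2 ≤
      Fintype.card d * gradNormSq (partialDeriv m u) := by
    intro m
    have hc2 : Continuous fun x => ∑ i, ‖partialDeriv i (partialDeriv m u) x‖ ^ 2 :=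
      continuous_finsetSum _ fun i _ => ((hD m).partialDeriv i).continuous.norm.pow 2
    calc ∫ x, ‖Torus.fderiv (partialDeriv m u) x‖ ^ 2
        ≤ ∫ x, (Fintype.card d : ℝ) * ∑ i, ‖partialDeriv i (partialDeriv m u) x‖ ^ 2 :=
          integral_mono ((hcD m).norm.pow 2).integrable_unitAddTorus
            (hc2.integrable_unitAddTorus.const_mul _)
            fun x => norm_fderiv_sq_le_card_mul_sum ((hD m).isContDiff (by simp)) x
      _ = Fintype.card d * gradNormSq (partialDeriv m u) := by rw [integral_const_mul, gradNormSq]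
  calc gradNormSq u = ∑ m, ∫ x, ‖partialDeriv m u x‖ ^ 2 := by
        rw [gradNormSq]
        exact integral_finsetSum _ fun m _ => ((hD m).continuous.norm.pow 2).integrable_unitAddTorus
    _ ≤ ∑ m, (Fintype.card d : ℝ) ^ 2 * (Fintype.card d * gradNormSq (partialDeriv m u)) :=
        Finset.sum_le_sum fun m _ => (hP m).trans (mul_le_mul_of_nonneg_left (hop m) (by positivity))
    _ = (Fintype.card d : ℝ) ^ 3 * ∑ m, gradNormSq (partialDeriv m u) := by
        rw [Finset.mul_sum]
        exact Finset.sum_congr rfl fun m _ => by ring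
    _ = (Fintype.card d : ℝ) ^ 3 * ∫ x, ‖laplacian u x‖ ^ 2 := by rw [sum_gradNormSq_partialDeriv_eq hu]

/-! ### `∫ |∇u|⁴` by Ladyzhenskaya's inequality -/

/-- **`∫ |∇u|⁴ ≤ K ‖∇u‖₂ ‖Δu‖₂³` on `T³`.** On `T^d` with `card d = 3` there is `K` such that
for every smooth `u : T^d → ℝ^d`,
`∫ (∑ₘ ‖∂ₘu‖²)² ≤ K (‖∇u‖₂²)^{1/2} (‖Δu‖₂²)^{3/2}`: `(∑ₘ cₘ)² ≤ d ∑ₘ cₘ²`, Ladyzhenskaya's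
inequality (`Torus.integral_norm_pow_four_le_of_hasZeroMean`) for the zero-mean smooth fields
`∂ₘu`, `∫ ‖∂ₘu‖² ≤ ‖∇u‖₂²`, `‖D∂ₘu‖² ≤ d ∑ᵢ ‖∂ᵢ∂ₘu‖²` and `gradNormSq_partialDeriv_le`.
[cite: FoiasManleyRosaTemam2001, Ch. II App. A (A.27)] -/
theorem integral_sum_norm_sq_partialDeriv_sq_le (hd : Fintype.card d = 3) :
    ∃ K : ℝ≥0, ∀ u : UnitAddTorus d → EuclideanSpace ℝ d, IsSmooth u →
      ∫ x, (∑ m, ‖partialDeriv m u x‖ ^ 2) ^ 2 ≤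
        K * gradNormSq u ^ (1 / 2 : ℝ) * (∫ x, ‖laplacian u x‖ ^ 2) ^ (3 / 2 : ℝ) := by
  obtain ⟨K₄, hK₄⟩ := integral_norm_pow_four_le_of_hasZeroMean (F' := EuclideanSpace ℝ d) hd
  refine ⟨243 * K₄, fun u hu => ?_⟩
  have hK0 : (0 : ℝ) ≤ K₄ := NNReal.coe_nonneg K₄
  set E : ℝ := gradNormSq u with hE
  set L : ℝ := ∫ x, ‖laplacian u x‖ ^ 2 with hLdef
  have hE0 : 0 ≤ E := gradNormSq_nonneg u
  have hL0 : 0 ≤ L := integral_nonneg fun x => sq_nonneg _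
  have hDs : ∀ m, IsSmooth (partialDeriv m u) := fun m => hu.partialDeriv m
  have hcθ : Continuous fun x => ∑ m, ‖partialDeriv m u x‖ ^ 2 :=
    continuous_finsetSum _ fun m _ => (hDs m).continuous.norm.pow 2
  -- ### Ladyzhenskaya for each `∂ₘu`
  have hLad : ∀ m, ∫ x, ‖partialDeriv m u x‖ ^ 4 ≤
      K₄ * E ^ (1 / 2 : ℝ) * ((Fintype.card d : ℝ) ^ 2 * L) ^ (3 / 2 : ℝ) := by
    intro m
    have h0 : HasZeroMean (partialDeriv m u) := integral_partialDeriv_eq_zero_holds hu m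
    have h := hK₄ (partialDeriv m u) (hDs m) h0
    -- `∫ ‖∂ₘu‖² ≤ E`
    have ha : ∫ x, ‖partialDeriv m u x‖ ^ 2 ≤ E := by
      rw [hE, gradNormSq]
      exact integral_mono ((hDs m).continuous.norm.pow 2).integrable_unitAddTorus
        hcθ.integrable_unitAddTorus fun x => Finset.single_le_sum
          (f := fun m => ‖partialDeriv m u x‖ ^ 2) (fun m _ => sq_nonneg _) (Finset.mem_univ m)
    -- `∫ ‖D∂ₘu‖² ≤ d · gradNormSq (∂ₘu) ≤ d² L`
    have hb : ∫ x, ‖Torus.fderiv (partialDeriv m u) x‖ ^ 2 ≤ (Fintype.card d : ℝ) ^ 2 * L := by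
      have h1 : ∀ x, ‖Torus.fderiv (partialDeriv m u) x‖ ^ 2 ≤
          Fintype.card d * ∑ i, ‖partialDeriv i (partialDeriv m u) x‖ ^ 2 := fun x =>
        norm_fderiv_sq_le_card_mul_sum ((hDs m).isContDiff (by simp)) x
      have hcD : Continuous fun x => ‖Torus.fderiv (partialDeriv m u) x‖ ^ 2 := by
        have e : lift (Torus.fderiv (partialDeriv m u)) = _root_.fderiv ℝ (lift (partialDeriv m u)) :=
          funext fun y => (fderiv_lift (partialDeriv m u) y).symm
        have hc : Continuous (Torus.fderiv (partialDeriv m u)) := by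
          rw [← continuous_lift_iff, e]
          exact ContDiff.continuous_fderiv ((hDs m).isContDiff (n := 1) (by simp)) one_ne_zero
        exact hc.norm.pow 2
      have hc2 : Continuous fun x => ∑ i, ‖partialDeriv i (partialDeriv m u) x‖ ^ 2 :=
        continuous_finsetSum _ fun i _ => ((hDs m).partialDeriv i).continuous.norm.pow 2
      calc ∫ x, ‖Torus.fderiv (partialDeriv m u) x‖ ^ 2
          ≤ ∫ x, (Fintype.card d : ℝ) * ∑ i, ‖partialDeriv i (partialDeriv m u) x‖ ^ 2 :=
            integral_mono hcD.integrable_unitAddTorus (hc2.integrable_unitAddTorus.const_mul _) h1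
        _ = Fintype.card d * gradNormSq (partialDeriv m u) := by rw [integral_const_mul, gradNormSq]
        _ ≤ Fintype.card d * (Fintype.card d * L) :=
            mul_le_mul_of_nonneg_left (gradNormSq_partialDeriv_le hu m) (Nat.cast_nonneg _)
        _ = (Fintype.card d : ℝ) ^ 2 * L := by ring
    have ha0 : 0 ≤ ∫ x, ‖partialDeriv m u x‖ ^ 2 := integral_nonneg fun x => sq_nonneg _
    have hb0 : 0 ≤ ∫ x, ‖Torus.fderiv (partialDeriv m u) x‖ ^ 2 := integral_nonneg fun x => sq_nonneg _
    calc ∫ x, ‖partialDeriv m u x‖ ^ 4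
        ≤ K₄ * (∫ x, ‖partialDeriv m u x‖ ^ 2) ^ (1 / 2 : ℝ) *
            (∫ x, ‖Torus.fderiv (partialDeriv m u) x‖ ^ 2) ^ (3 / 2 : ℝ) := h
      _ ≤ K₄ * E ^ (1 / 2 : ℝ) * ((Fintype.card d : ℝ) ^ 2 * L) ^ (3 / 2 : ℝ) := by
          gcongr
  -- ### `(∑ₘ cₘ)² ≤ d ∑ₘ cₘ²` and integration
  have hpt : ∀ x, (∑ m, ‖partialDeriv m u x‖ ^ 2) ^ 2 ≤
      Fintype.card d * ∑ m, ‖partialDeriv m u x‖ ^ 4 := fun x => by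
    have h := sq_sum_le_card_mul_sum_sq (s := (Finset.univ : Finset d))
      (f := fun m => ‖partialDeriv m u x‖ ^ 2)
    rw [Finset.card_univ] at h
    refine h.trans (le_of_eq ?_)
    congr 1
    exact Finset.sum_congr rfl fun m _ => by ring
  have hint4 : ∀ m, Integrable (fun x => ‖partialDeriv m u x‖ ^ 4) volume :=
    fun m => ((hDs m).continuous.norm.pow 4).integrable_unitAddTorus
  have hd2 : (Fintype.card d : ℝ) ^ 2 = 9 := by rw [hd]; norm_num
  have h27 : ((9 : ℝ) * L) ^ (3 / 2 : ℝ) = 27 * L ^ (3 / 2 : ℝ) := by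
    rw [Real.mul_rpow (by norm_num) hL0]
    congr 1
    rw [show (9 : ℝ) = 3 ^ ((2 : ℕ) : ℝ) by norm_num, ← Real.rpow_mul (by norm_num)]
    norm_num
  calc ∫ x, (∑ m, ‖partialDeriv m u x‖ ^ 2) ^ 2
      ≤ ∫ x, (Fintype.card d : ℝ) * ∑ m, ‖partialDeriv m u x‖ ^ 4 :=
        integral_mono (hcθ.pow 2).integrable_unitAddTorus
          ((integrable_finsetSum _ fun m _ => hint4 m).const_mul _) hpt
    _ = Fintype.card d * ∑ m, ∫ x, ‖partialDeriv m u x‖ ^ 4 := by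
        rw [integral_const_mul, integral_finsetSum _ fun m _ => hint4 m]
    _ ≤ Fintype.card d * ∑ _m : d, K₄ * E ^ (1 / 2 : ℝ) * ((Fintype.card d : ℝ) ^ 2 * L) ^ (3 / 2 : ℝ) :=
        mul_le_mul_of_nonneg_left (Finset.sum_le_sum fun m _ => hLad m) (Nat.cast_nonneg _)
    _ = ((243 * K₄ : ℝ≥0) : ℝ) * E ^ (1 / 2 : ℝ) * L ^ (3 / 2 : ℝ) := by
        rw [Finset.sum_const, Finset.card_univ, nsmul_eq_mul, hd2, h27, hd]
        push_cast
        ring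

/-! ### The trilinear estimate -/

/-- **FMRT (A.26b) for `b(u, u, Au)`: the inertial term against the Laplacian on `T³`.** On
`T^d` with `card d = 3` there is `K` such that for every smooth divergence-free vector field
`u : T^d → ℝ^d`,
`|∫ ⟪(u·∇)u, Δu⟫| ≤ K (‖∇u‖₂²)^{3/4} (‖Δu‖₂²)^{3/4}`, i.e. `≤ K ‖∇u‖₂^{3/2} ‖Δu‖₂^{3/2}`
(Foias–Manley–Rosa–Temam 2001, Ch. II App. A (A.26b): "`|b(u, v, w)| ≤ c₁ ‖u‖^{1/2} |Au|^{1/2}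
‖v‖ |w|`, `u ∈ D(A)`, `v ∈ V`, `w ∈ H`" with `v = u`, `w = Au`). Proof: by
`Torus.integral_inner_laplacian_convect_self_eq_neg` the integral is minus that of the cubic
density, bounded pointwise by `d² |∇u|² √(|∇u|²)`; Cauchy–Schwarz gives
`∫ |∇u|²·|∇u| ≤ (∫ |∇u|⁴)^{1/2} ‖∇u‖₂`, and `∫ |∇u|⁴ ≤ K' ‖∇u‖₂ ‖Δu‖₂³`
(`integral_sum_norm_sq_partialDeriv_sq_le`). [cite: FoiasManleyRosaTemam2001, Ch. II App. A (A.26b)] -/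
theorem abs_integral_inner_convect_laplacian_le (hd : Fintype.card d = 3) :
    ∃ K : ℝ≥0, ∀ u : UnitAddTorus d → EuclideanSpace ℝ d, IsSmooth u → IsDivFree u →
      |∫ x, ⟪convect u u x, laplacian u x⟫_ℝ| ≤
        K * gradNormSq u ^ (3 / 4 : ℝ) * (∫ x, ‖laplacian u x‖ ^ 2) ^ (3 / 4 : ℝ) := by
  obtain ⟨K₁, hK₁⟩ := integral_sum_norm_sq_partialDeriv_sq_le (d := d) hd
  refine ⟨9 * NNReal.sqrt K₁, fun u hu hdiv => ?_⟩
  have hK0 : (0 : ℝ) ≤ K₁ := NNReal.coe_nonneg K₁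
  set E : ℝ := gradNormSq u with hE
  set L : ℝ := ∫ x, ‖laplacian u x‖ ^ 2 with hLdef
  have hE0 : 0 ≤ E := gradNormSq_nonneg u
  have hL0 : 0 ≤ L := integral_nonneg fun x => sq_nonneg _
  set θ : UnitAddTorus d → ℝ := fun x => ∑ m, ‖partialDeriv m u x‖ ^ 2 with hθdef
  have hθ0 : ∀ x, 0 ≤ θ x := fun x => Finset.sum_nonneg fun m _ => sq_nonneg _
  have hDs : ∀ m, IsSmooth (partialDeriv m u) := fun m => hu.partialDeriv m
  have hcθ : Continuous θ := continuous_finsetSum _ fun m _ => (hDs m).continuous.norm.pow 2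
  have hEθ : ∫ x, θ x = E := rfl
  -- quarter powers: `e = E^{1/4}`, `l = L^{1/4}`
  set e : ℝ := E ^ (1 / 4 : ℝ) with he
  set l : ℝ := L ^ (1 / 4 : ℝ) with hl
  have he0 : 0 ≤ e := Real.rpow_nonneg hE0 _
  have hl0 : 0 ≤ l := Real.rpow_nonneg hL0 _
  have he2 : E ^ (1 / 2 : ℝ) = e ^ 2 := by
    rw [he, ← Real.rpow_natCast, ← Real.rpow_mul hE0]; norm_num
  have he3 : E ^ (3 / 4 : ℝ) = e ^ 3 := by
    rw [he, ← Real.rpow_natCast, ← Real.rpow_mul hE0]; norm_num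
  have he4 : E = e ^ 4 := by
    rw [he, ← Real.rpow_natCast, ← Real.rpow_mul hE0]; norm_num
  have hl3 : L ^ (3 / 4 : ℝ) = l ^ 3 := by
    rw [hl, ← Real.rpow_natCast, ← Real.rpow_mul hL0]; norm_num
  have hl6 : L ^ (3 / 2 : ℝ) = l ^ 6 := by
    rw [hl, ← Real.rpow_natCast, ← Real.rpow_mul hL0]; norm_num
  -- ### Step 1: the identity and the pointwise bound, `|∫ ⟪(u·∇)u, Δu⟫| ≤ 9 ∫ θ √θ`
  have hcubic_cont : Continuous fun x => ∑ m, ∑ i, partialDeriv m u x i *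
      ⟪partialDeriv m u x, partialDeriv i u x⟫_ℝ :=
    continuous_finsetSum _ fun m _ => continuous_finsetSum _ fun i _ =>
      (((hDs m).apply i).continuous).mul (((hDs m).continuous).inner ((hDs i).continuous))
  have hstep1 : |∫ x, ⟪convect u u x, laplacian u x⟫_ℝ| ≤ 9 * ∫ x, θ x * Real.sqrt (θ x) := by
    have hcomm : ∫ x, ⟪convect u u x, laplacian u x⟫_ℝ = ∫ x, ⟪laplacian u x, convect u u x⟫_ℝ :=
      integral_congr_ae (ae_of_all _ fun x => real_inner_comm _ _)
    rw [hcomm, integral_inner_laplacian_convect_self_eq_neg hu hdiv, abs_neg]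
    calc |∫ x, ∑ m, ∑ i, partialDeriv m u x i * ⟪partialDeriv m u x, partialDeriv i u x⟫_ℝ|
        ≤ ∫ x, |∑ m, ∑ i, partialDeriv m u x i * ⟪partialDeriv m u x, partialDeriv i u x⟫_ℝ| :=
          abs_integral_le_integral_abs
      _ ≤ ∫ x, (Fintype.card d : ℝ) ^ 2 * θ x * Real.sqrt (θ x) :=
          integral_mono hcubic_cont.abs.integrable_unitAddTorus
            (((continuous_const.mul hcθ).mul hcθ.sqrt).integrable_unitAddTorus)
            fun x => abs_sum_partialDeriv_mul_inner_le u x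
      _ = 9 * ∫ x, θ x * Real.sqrt (θ x) := by
          rw [← integral_const_mul]
          refine integral_congr_ae (ae_of_all _ fun x => ?_)
          rw [hd]
          push_cast
          ring
  -- ### Step 2: Cauchy–Schwarz, `∫ θ √θ ≤ √(∫ θ²) · √E`
  have hstep2 : ∫ x, θ x * Real.sqrt (θ x) ≤ Real.sqrt (∫ x, θ x ^ 2) * Real.sqrt E := by
    have hf : MemLp θ (ENNReal.ofReal 2) volume :=
      hcθ.memLp_of_hasCompactSupport (HasCompactSupport.of_compactSpace θ)
    have hg : MemLp (fun x => Real.sqrt (θ x)) (ENNReal.ofReal 2) volume :=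
      hcθ.sqrt.memLp_of_hasCompactSupport (HasCompactSupport.of_compactSpace _)
    have h := integral_mul_le_Lp_mul_Lq_of_nonneg (μ := volume) Real.HolderConjugate.two_two
      (ae_of_all _ hθ0) (ae_of_all _ fun x => Real.sqrt_nonneg (θ x)) hf hg
    have e1 : ∫ x, θ x ^ (2 : ℝ) = ∫ x, θ x ^ 2 := integral_congr_ae (ae_of_all _ fun x => Real.rpow_two _)
    have e2 : ∫ x, Real.sqrt (θ x) ^ (2 : ℝ) = E := by
      rw [← hEθ]
      exact integral_congr_ae (ae_of_all _ fun x => by simp only [Real.rpow_two, Real.sq_sqrt (hθ0 x)])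
    rw [e1, e2] at h
    rw [Real.sqrt_eq_rpow, Real.sqrt_eq_rpow]
    exact h
  -- ### Step 3: `∫ θ² ≤ K₁ E^{1/2} L^{3/2} = K₁ e² l⁶`
  have hstep3 : ∫ x, θ x ^ 2 ≤ K₁ * e ^ 2 * l ^ 6 := by
    have h := hK₁ u hu
    rw [he2, hl6] at h
    exact h
  -- ### assembly
  have hsqrtE : Real.sqrt E = e ^ 2 := by
    rw [Real.sqrt_eq_rpow, he2]
  have hsqrt3 : Real.sqrt (∫ x, θ x ^ 2) ≤ Real.sqrt K₁ * e * l ^ 3 := by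
    calc Real.sqrt (∫ x, θ x ^ 2) ≤ Real.sqrt (K₁ * e ^ 2 * l ^ 6) := Real.sqrt_le_sqrt hstep3
      _ = Real.sqrt K₁ * e * l ^ 3 := by
          rw [show (K₁ : ℝ) * e ^ 2 * l ^ 6 = K₁ * (e * l ^ 3) ^ 2 by ring,
            Real.sqrt_mul hK0, Real.sqrt_sq (by positivity)]
          ring
  calc |∫ x, ⟪convect u u x, laplacian u x⟫_ℝ| ≤ 9 * ∫ x, θ x * Real.sqrt (θ x) := hstep1
    _ ≤ 9 * (Real.sqrt (∫ x, θ x ^ 2) * Real.sqrt E) := by gcongr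
    _ ≤ 9 * (Real.sqrt K₁ * e * l ^ 3 * e ^ 2) := by
        rw [hsqrtE]
        gcongr
    _ = ((9 * NNReal.sqrt K₁ : ℝ≥0) : ℝ) * E ^ (3 / 4 : ℝ) * L ^ (3 / 4 : ℝ) := by
        rw [he3, hl3]
        push_cast
        ring

/-- **The dissipation form of the trilinear estimate** (the step "Young's inequality" of every
enstrophy argument, e.g. FMRT 2001, Ch. II (A.44)–(A.46); BMN 1999, §5): with the constant `K` of
`abs_integral_inner_convect_laplacian_le`, for every `ν > 0` and every smooth divergence-free
`u` on `T³`,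
`|∫ ⟪(u·∇)u, Δu⟫| ≤ (ν/2) ‖Δu‖₂² + (8K⁴/ν³) (‖∇u‖₂²)³`
(if `K (‖∇u‖₂²)^{3/4} ≤ (ν/2) (‖Δu‖₂²)^{1/4}` the first term dominates, otherwise
`‖Δu‖₂² < (2K/ν)⁴ (‖∇u‖₂²)³` and the bound is at most the second term). [folklore] -/
theorem abs_integral_inner_convect_laplacian_le_dissipation (hd : Fintype.card d = 3) :
    ∃ K : ℝ≥0, ∀ (ν : ℝ), 0 < ν → ∀ u : UnitAddTorus d → EuclideanSpace ℝ d, IsSmooth u → IsDivFree u →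
      |∫ x, ⟪convect u u x, laplacian u x⟫_ℝ| ≤
        ν / 2 * (∫ x, ‖laplacian u x‖ ^ 2) + 8 * (K : ℝ) ^ 4 / ν ^ 3 * gradNormSq u ^ 3 := by
  obtain ⟨K, hK⟩ := abs_integral_inner_convect_laplacian_le (d := d) hd
  refine ⟨K, fun ν hν u hu hdiv => ?_⟩
  have h := hK u hu hdiv
  have hK0 : (0 : ℝ) ≤ K := NNReal.coe_nonneg K
  set E : ℝ := gradNormSq u with hE
  set L : ℝ := ∫ x, ‖laplacian u x‖ ^ 2 with hLdef
  have hE0 : 0 ≤ E := gradNormSq_nonneg u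
  have hL0 : 0 ≤ L := integral_nonneg fun x => sq_nonneg _
  set e : ℝ := E ^ (1 / 4 : ℝ) with he
  set l : ℝ := L ^ (1 / 4 : ℝ) with hl
  have he0 : 0 ≤ e := Real.rpow_nonneg hE0 _
  have hl0 : 0 ≤ l := Real.rpow_nonneg hL0 _
  have he3 : E ^ (3 / 4 : ℝ) = e ^ 3 := by
    rw [he, ← Real.rpow_natCast, ← Real.rpow_mul hE0]; norm_num
  have he4 : E = e ^ 4 := by
    rw [he, ← Real.rpow_natCast, ← Real.rpow_mul hE0]; norm_num
  have hl3 : L ^ (3 / 4 : ℝ) = l ^ 3 := by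
    rw [hl, ← Real.rpow_natCast, ← Real.rpow_mul hL0]; norm_num
  have hl4 : L = l ^ 4 := by
    rw [hl, ← Real.rpow_natCast, ← Real.rpow_mul hL0]; norm_num
  rw [he3, hl3] at h
  -- `|I| ≤ K e³ l³`; compare `K e³` with `(ν/2) l`
  have hE3 : E ^ 3 = e ^ 12 := by rw [he4]; ring
  rw [hl4, hE3]
  rcases le_or_gt (K * e ^ 3) (ν / 2 * l) with hc | hc
  · -- dissipation dominates
    calc |∫ x, ⟪convect u u x, laplacian u x⟫_ℝ| ≤ K * e ^ 3 * l ^ 3 := h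
      _ ≤ ν / 2 * l * l ^ 3 := mul_le_mul_of_nonneg_right hc (pow_nonneg hl0 3)
      _ = ν / 2 * l ^ 4 := by ring
      _ ≤ ν / 2 * l ^ 4 + 8 * (K : ℝ) ^ 4 / ν ^ 3 * e ^ 12 :=
          le_add_of_nonneg_right (by positivity)
  · -- `l < (2K/ν) e³`
    have hl' : l < 2 * K / ν * e ^ 3 := by
      have h2 : l * ν < 2 * K * e ^ 3 := by nlinarith [hc]
      rw [div_mul_eq_mul_div, lt_div_iff₀ hν]
      exact h2
    have hl3' : l ^ 3 ≤ (2 * K / ν * e ^ 3) ^ 3 := pow_le_pow_left₀ hl0 hl'.le 3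
    calc |∫ x, ⟪convect u u x, laplacian u x⟫_ℝ| ≤ K * e ^ 3 * l ^ 3 := h
      _ ≤ K * e ^ 3 * (2 * K / ν * e ^ 3) ^ 3 := mul_le_mul_of_nonneg_left hl3' (by positivity)
      _ = 8 * (K : ℝ) ^ 4 / ν ^ 3 * e ^ 12 := by field_simp; ring
      _ ≤ ν / 2 * l ^ 4 + 8 * (K : ℝ) ^ 4 / ν ^ 3 * e ^ 12 :=
          le_add_of_nonneg_left (by positivity)

end Torus

end Literature.Analysis.FunctionSpaces

end
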